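import Literature.NumberTheory.GaloisRepresentations.HeckeCharacterOfRayClass
import Literature.NumberTheory.GaloisRepresentations.HeckeCharacterAutConj
import HarnessLib

/-!
# Größencharaktere `mod 𝔣` of infinity type `(p, q)` and the idele character `ω₀`

Topic `NumberTheory/GaloisRepresentations`; namespace `Literature.NumberTheory.GaloisRepresentations`.
First half (the character `ω₀` of the idele group and its triviality on the ray) of the proof that
**every Größencharakter `mod 𝔣` of infinity type `(p, q)` is induced by an algebraic Hecke character**
(`HeckeCharacterOfGrossencharakter.lean`, `HeckeCharacter.exists_of_isGrossencharakter`), the converse of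
`HeckeCharacter.HasInfinityType.idealPow_span_eq` (`AlgebraicHeckeCharacterGrossencharakterProofs.lean`)
and the infinite-order analogue of `HeckeCharacterOfRayClass.lean` (Cassels–Fröhlich VII (Tate)
Prop. 4.1 / Neukirch VI (1.9), VII (6.13)–(6.14)).  Everything here is **proved**; there is no named fact.

* `IsGrossencharakter 𝔣 p q ψ` — the datum of Neukirch VII Def. (6.1)/(6.14) and Weil 1956 §1
  (type `A₀`), given by the values `ψ` on the primes `𝔭 ∤ 𝔣`: nonzero, and for nonzero integers
  `b ≡ c mod 𝔣` with `c` prime to `𝔣` and `b/c` totally positive,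
  `χ̃((b)) = χ̃((c)) · ∏_w σ_w(b/c)^{p_w} \overline{σ_w(b/c)}^{q_w}` (`χ̃ = LFunctions.idealPow K ψ`).
* `grossIdeleValue hψ x = ω₀(x) = ∏_{𝔭 ∤ 𝔣} ψ(𝔭)^{ord_𝔭 x} · A_{p,q}(x_∞)` (`A_{p,q}` the archimedean
  factor `HeckeCharacter.archFactor`, as the idele character `HeckeCharacter.archIdeleChar`), a
  homomorphism on `𝕀_K` with `ω₀(⟨ϖ_𝔭⟩) = ψ(𝔭)`, and **`ω₀ = 1` on `Kˣ ∩ W_𝔣`**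
  (`grossIdeleValue_principalIdele_eq_one`): for `k ≡ 1 mod^× 𝔣` totally positive, `k = b/d` with `d`
  prime to `𝔣` (`exists_denom_prime_to`), and the Größencharakter relation for `(b, d)` is cancelled
  exactly by `A_{p,q}((k)_∞) = ∏_w σ_w(k)^{-p_w} σ̄_w(k)^{-q_w}`.

## References

* J. Neukirch, *Algebraic Number Theory* (1999), Ch. VI §1 (1.9); Ch. VII §6 Def. (6.1),
  Prop. (6.13), Cor. (6.14). [NeukirchANT1999]
* A. Weil, *On a certain type of characters of the idèle-class group of an algebraic number-field*,
  Proc. Int. Symp. Tokyo–Nikko 1955 (1956), 1–7, §1. [Weil1956]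
* J. W. S. Cassels, A. Fröhlich (eds.), *Algebraic Number Theory* (1967), Ch. VII (Tate) §4
  Prop. 4.1. [CasselsFrohlichANT1967]
-/

noncomputable section

open NumberField IsDedekindDomain IsDedekindDomain.HeightOneSpectrum Filter Topology
open scoped nonZeroDivisors ComplexConjugate

namespace Literature.NumberTheory.GaloisRepresentations

variable {K : Type*} [Field K] [NumberField K]

/-- **A Größencharakter `mod 𝔣` of infinity type `(p, q)`**, given by its values `ψ` on the primes:
`ψ(𝔭) ≠ 0` for `𝔭 ∤ 𝔣`, and for nonzero integers `b, c` with `c` prime to `𝔣`, `b - c ∈ 𝔣` and `b/c`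
totally positive, `χ̃((b)) = χ̃((c)) · ∏_w σ_w(b/c)^{p_w} \overline{σ_w(b/c)}^{q_w}` where
`χ̃ = LFunctions.idealPow K ψ` — i.e. `χ̃((a)) = ∏_w σ_w(a)^{p_w} σ̄_w(a)^{q_w}` on the ray `P^𝔣`
(Neukirch VII Def. (6.1): a character of `J^𝔪` with `χ((a)) = χ_f(a) χ_∞(a)`, `χ_f` trivial on
`a ≡ 1 mod 𝔪`; Weil 1956 §1, type `(A₀)`).  The shape is verbatim the conclusion of
`HeckeCharacter.HasInfinityType.idealPow_span_eq`; for `p = q = 0` it is the ray condition of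
`LFunctions.IsRayClassCharacter`. [cite: NeukirchANT1999, Ch. VII §6 Def. (6.1) and Cor. (6.14)] -/
structure IsGrossencharakter (𝔣 : Ideal (𝓞 K)) (p q : InfinitePlace K → ℤ)
    (ψ : HeightOneSpectrum (𝓞 K) → ℂ) : Prop where
  /-- Nonzero values on the primes not dividing `𝔣`. -/
  ne_zero : ∀ v : HeightOneSpectrum (𝓞 K), ¬ 𝔣 ≤ v.asIdeal → ψ v ≠ 0
  /-- The infinity type on the ray `P^𝔣`. -/
  idealPow_span_eq : ∀ b c : 𝓞 K, b ≠ 0 → c ≠ 0 → IsCoprime (Ideal.span {c}) 𝔣 → b - c ∈ 𝔣 →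
    (∀ φ : K →+* ℝ, 0 < φ b * φ c) →
      LFunctions.idealPow K ψ (Ideal.span {b}) = LFunctions.idealPow K ψ (Ideal.span {c}) *
        ∏ w : InfinitePlace K, w.embedding ((b : K) / c) ^ (p w) * conj (w.embedding ((b : K) / c)) ^ (q w)

/-! ### The character `ω₀(x) = ∏_{𝔭 ∤ 𝔣} ψ(𝔭)^{ord_𝔭 x} · A_{p,q}(x_∞)` of the idele group -/

section IdeleValue

variable {𝔣 : Ideal (𝓞 K)} {p q : InfinitePlace K → ℤ} {ψ : HeightOneSpectrum (𝓞 K) → ℂ}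

/-- The values of `ψ` off `𝔣` as units of `ℂ`, and `1` at the primes dividing `𝔣`. [folklore] -/
def grossUnitValue (hψ : IsGrossencharakter 𝔣 p q ψ) (v : HeightOneSpectrum (𝓞 K)) : ℂˣ :=
  open scoped Classical in
  if hv : 𝔣 ≤ v.asIdeal then 1 else Units.mk0 (ψ v) (hψ.ne_zero v hv)

/-- Off `𝔣` the unit value is `ψ(𝔭)`. [folklore] -/
theorem coe_grossUnitValue_of_not_le (hψ : IsGrossencharakter 𝔣 p q ψ)
    {v : HeightOneSpectrum (𝓞 K)} (hv : ¬ 𝔣 ≤ v.asIdeal) : (grossUnitValue hψ v : ℂ) = ψ v := by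
  classical
  rw [grossUnitValue, dif_neg hv, Units.val_mk0]

/-- On `𝔣` the unit value is `1`. [folklore] -/
theorem grossUnitValue_of_le (hψ : IsGrossencharakter 𝔣 p q ψ) {v : HeightOneSpectrum (𝓞 K)}
    (hv : 𝔣 ≤ v.asIdeal) : grossUnitValue hψ v = 1 := by
  classical
  rw [grossUnitValue, dif_pos hv]

/-- The finite part `∏_{𝔭 ∤ 𝔣} ψ(𝔭)^{ord_𝔭 x} = χ̃((x)^𝔣)` of `ω₀` (Neukirch VI (1.9):
`α ↦ (α) = ∏_{𝔭 ∤ ∞} 𝔭^{v_𝔭(α_𝔭)}`). [cite: NeukirchANT1999, Ch. VI §1 Prop. (1.9)] -/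
def grossFinValue (hψ : IsGrossencharakter 𝔣 p q ψ) (x : ideleGroup K) : ℂˣ :=
  ∏ᶠ v : HeightOneSpectrum (𝓞 K), grossUnitValue hψ v ^ ideleOrd x v

/-- The product defining `grossFinValue` is finite. [folklore] -/
theorem mulSupport_grossUnitValue_zpow_finite (hψ : IsGrossencharakter 𝔣 p q ψ) (x : ideleGroup K) :
    (Function.mulSupport fun v : HeightOneSpectrum (𝓞 K) => grossUnitValue hψ v ^ ideleOrd x v).Finite := by
  refine (Filter.eventually_cofinite.mp (ideleOrd_eventually_eq_zero x)).subset fun v hv => ?_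
  rw [Function.mem_mulSupport] at hv
  intro h0
  exact hv (by rw [h0, zpow_zero])

/-- `χ̃((x y)) = χ̃((x)) χ̃((y))`. [folklore] -/
theorem grossFinValue_mul (hψ : IsGrossencharakter 𝔣 p q ψ) (x y : ideleGroup K) :
    grossFinValue hψ (x * y) = grossFinValue hψ x * grossFinValue hψ y := by
  unfold grossFinValue
  rw [← finprod_mul_distrib (mulSupport_grossUnitValue_zpow_finite hψ x)
    (mulSupport_grossUnitValue_zpow_finite hψ y)]
  exact finprod_congr fun v => by rw [ideleOrd_mul, zpow_add]

/-- `χ̃((x)^𝔣) = 1` as soon as `ord_𝔭 x = 0` for all `𝔭 ∤ 𝔣`. [folklore] -/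
theorem grossFinValue_eq_one_of_forall (hψ : IsGrossencharakter 𝔣 p q ψ) {x : ideleGroup K}
    (h : ∀ v : HeightOneSpectrum (𝓞 K), ¬ 𝔣 ≤ v.asIdeal → ideleOrd x v = 0) : grossFinValue hψ x = 1 := by
  refine finprod_eq_one_of_forall_eq_one fun v => ?_
  by_cases hv : 𝔣 ≤ v.asIdeal
  · rw [grossUnitValue_of_le hψ hv, one_zpow]
  · rw [h v hv, zpow_zero]

/-- `χ̃` kills the unit ideles. [folklore] -/
theorem grossFinValue_eq_one_of_mem_unitIdeles (hψ : IsGrossencharakter 𝔣 p q ψ) {x : ideleGroup K}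
    (hx : x ∈ unitIdeles K) : grossFinValue hψ x = 1 :=
  grossFinValue_eq_one_of_forall hψ fun v _ => (ideleOrd_eq_zero_iff x v).mpr (hx v)

/-- `χ̃` kills the infinite ideles `(x, 1)`. [folklore] -/
theorem grossFinValue_infiniteIdeles (hψ : IsGrossencharakter 𝔣 p q ψ) (x : (InfiniteAdeleRing K)ˣ) :
    grossFinValue hψ (infiniteIdeles K x) = 1 :=
  grossFinValue_eq_one_of_forall hψ fun v _ => (ideleOrd_eq_zero_iff _ v).mpr (by
    rw [infiniteIdeles_snd, map_one])

/-- `χ̃((⟨u⟩_v)) = ψ⁺(v)^{ord_v u}`. [folklore] -/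
theorem grossFinValue_localUnits (hψ : IsGrossencharakter 𝔣 p q ψ) (v : HeightOneSpectrum (𝓞 K))
    (u : (v.adicCompletion K)ˣ) :
    grossFinValue hψ (localUnits v u) =
      grossUnitValue hψ v ^ (-WithZero.log (Valued.v (u : v.adicCompletion K))) := by
  unfold grossFinValue
  rw [finprod_eq_single _ v fun w hw => by rw [ideleOrd_localUnits_of_ne u hw, zpow_zero],
    ideleOrd_localUnits_self]

/-- The infinite part of a local idele `⟨u⟩_v` is trivial (private copy of
`Automorphic.infPart_localUnits` of `TorusSecondCoordinateIntegral`, not imported). [folklore] -/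
private theorem infPart_localUnits' (v : HeightOneSpectrum (𝓞 K)) (u : (v.adicCompletion K)ˣ) :
    HeckeCharacter.infPart K (localUnits v u) = 1 :=
  Units.ext (localUnits_fst v u)

/-- **The character `ω₀` of the idele group**:
`ω₀(x) = ∏_{𝔭 ∤ 𝔣} ψ(𝔭)^{ord_𝔭 x} · A_{p,q}(x_∞)`, `A_{p,q}(y) = ∏_w ι_w(y_w)^{-p_w} \overline{ι_w(y_w)}^{-q_w}`
(`HeckeCharacter.archIdeleChar`).  For `p = q = 0` this is `rayIdeleValue`.
[cite: CasselsFrohlichANT1967, Ch. VII §4 Prop. 4.1 (proof)] -/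
def grossIdeleValue (hψ : IsGrossencharakter 𝔣 p q ψ) (x : ideleGroup K) : ℂˣ :=
  grossFinValue hψ x * HeckeCharacter.archIdeleChar p q x

/-- Unfolding `grossIdeleValue`. [folklore] -/
theorem grossIdeleValue_def (hψ : IsGrossencharakter 𝔣 p q ψ) (x : ideleGroup K) :
    grossIdeleValue hψ x = grossFinValue hψ x * HeckeCharacter.archIdeleChar p q x := rfl

/-- `ω₀(x y) = ω₀(x) ω₀(y)`. [folklore] -/
theorem grossIdeleValue_mul (hψ : IsGrossencharakter 𝔣 p q ψ) (x y : ideleGroup K) :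
    grossIdeleValue hψ (x * y) = grossIdeleValue hψ x * grossIdeleValue hψ y := by
  rw [grossIdeleValue_def, grossIdeleValue_def, grossIdeleValue_def, grossFinValue_mul, map_mul]
  simp only [mul_assoc, mul_left_comm (grossFinValue hψ y)]

/-- `ω₀(1) = 1`. [folklore] -/
theorem grossIdeleValue_one (hψ : IsGrossencharakter 𝔣 p q ψ) : grossIdeleValue hψ (1 : ideleGroup K) = 1 := by
  rw [grossIdeleValue_def, map_one, mul_one]
  exact grossFinValue_eq_one_of_forall hψ fun v _ => ideleOrd_one v

/-- `ω₀(⟨u⟩_v) = ψ⁺(v)^{ord_v u}` (the local idele has trivial infinite part). [folklore] -/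
theorem grossIdeleValue_localUnits (hψ : IsGrossencharakter 𝔣 p q ψ) (v : HeightOneSpectrum (𝓞 K))
    (u : (v.adicCompletion K)ˣ) :
    grossIdeleValue hψ (localUnits v u) =
      grossUnitValue hψ v ^ (-WithZero.log (Valued.v (u : v.adicCompletion K))) := by
  rw [grossIdeleValue_def, grossFinValue_localUnits]
  have : HeckeCharacter.archIdeleChar p q (localUnits v u) = 1 := by
    refine Units.ext ?_
    rw [HeckeCharacter.coe_archIdeleChar_apply, infPart_localUnits', map_one, Units.val_one]
  rw [this, mul_one]

/-- `ω₀` kills `⟨u⟩_v` for a local unit `u ∈ 𝒪_vˣ`. [folklore] -/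
theorem grossIdeleValue_localUnits_of_valued_eq_one (hψ : IsGrossencharakter 𝔣 p q ψ)
    (v : HeightOneSpectrum (𝓞 K)) {u : (v.adicCompletion K)ˣ} (hu : Valued.v (u : v.adicCompletion K) = 1) :
    grossIdeleValue hψ (localUnits v u) = 1 := by
  rw [grossIdeleValue_localUnits, hu, WithZero.log_one, neg_zero, zpow_zero]

/-- **`ω₀(⟨ϖ_v⟩) = ψ(𝔭_v)` for `𝔭_v ∤ 𝔣`** (Neukirch VII (6.14): `χ̃(𝔭) = χ(⟨π_𝔭⟩)`). [folklore] -/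
theorem coe_grossIdeleValue_localUnits_uniformizer (hψ : IsGrossencharakter 𝔣 p q ψ)
    {v : HeightOneSpectrum (𝓞 K)} (hv : ¬ 𝔣 ≤ v.asIdeal) :
    (grossIdeleValue hψ (localUnits v (HeckeCharacter.uniformizer K v)) : ℂ) = ψ v := by
  rw [grossIdeleValue_localUnits, HeckeCharacter.valued_uniformizer, WithZero.log_exp, neg_neg, zpow_one,
    coe_grossUnitValue_of_not_le hψ hv]

/-! #### `ω₀` is trivial on the principal ideles of the ray -/

/-- The product `∏_𝔭 ψ⁺(𝔭)^{ν_𝔭((b))}` is finite. [folklore] -/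
theorem mulSupport_grossUnitValue_pow_count_finite (hψ : IsGrossencharakter 𝔣 p q ψ) {b : 𝓞 K} (hb : b ≠ 0) :
    (Function.mulSupport fun v : HeightOneSpectrum (𝓞 K) => grossUnitValue hψ v ^
      ((Associates.mk v.asIdeal).count (Associates.mk (Ideal.span {b} : Ideal (𝓞 K))).factors : ℤ)).Finite := by
  refine (LFunctions.mulSupport_idealPow_finite ψ
    ((Submodule.ne_bot_iff _).mpr ⟨b, Ideal.mem_span_singleton_self b, hb⟩)).subset fun v hv => ?_
  rw [Function.mem_mulSupport] at hv ⊢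
  intro h0
  by_cases hvf : 𝔣 ≤ v.asIdeal
  · exact hv (by rw [grossUnitValue_of_le hψ hvf, one_zpow])
  · apply hv
    rw [zpow_natCast]
    refine Units.ext ?_
    rw [Units.val_pow_eq_pow_val, coe_grossUnitValue_of_not_le hψ hvf, h0, Units.val_one]

/-- For a nonzero integer `b` prime to `𝔣`, `∏_𝔭 ψ⁺(𝔭)^{ν_𝔭((b))} = χ̃((b))`. [folklore] -/
theorem coe_finprod_grossUnitValue_pow_count (h𝔣 : 𝔣 ≠ ⊥) (hψ : IsGrossencharakter 𝔣 p q ψ)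
    {b : 𝓞 K} (hb : b ≠ 0) (hcop : IsCoprime (Ideal.span {b}) 𝔣) :
    ((∏ᶠ v : HeightOneSpectrum (𝓞 K), grossUnitValue hψ v ^
        ((Associates.mk v.asIdeal).count (Associates.mk (Ideal.span {b} : Ideal (𝓞 K))).factors : ℤ) : ℂˣ) : ℂ) =
      LFunctions.idealPow K ψ (Ideal.span {b}) := by
  rw [← Units.coeHom_apply, MonoidHom.map_finprod _ (mulSupport_grossUnitValue_pow_count_finite hψ hb),
    LFunctions.idealPow]
  refine finprod_congr fun v => ?_
  rw [Units.coeHom_apply, zpow_natCast, Units.val_pow_eq_pow_val]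
  by_cases hvf : 𝔣 ≤ v.asIdeal
  · rw [count_span_eq_zero_of_isCoprime h𝔣 hb hcop hvf, pow_zero, pow_zero]
  · rw [coe_grossUnitValue_of_not_le hψ hvf]

/-- The archimedean factor of a principal infinite idele cancels the infinity type:
`A_{p,q}((k)_∞) · ∏_w σ_w(k)^{p_w} \overline{σ_w(k)}^{q_w} = 1`. [folklore] -/
theorem archFactor_globalToInfiniteUnits_mul_prod (p q : InfinitePlace K → ℤ) (k : Kˣ) :
    HeckeCharacter.archFactor p q (globalToInfiniteUnits K k) *
      ∏ w : InfinitePlace K, w.embedding (k : K) ^ (p w) * conj (w.embedding (k : K)) ^ (q w) = 1 := by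
  rw [HeckeCharacter.archFactor_globalToInfiniteUnits, ← Finset.prod_mul_distrib]
  refine Finset.prod_eq_one fun w _ => ?_
  have hk : w.embedding (k : K) ≠ 0 := (map_ne_zero _).mpr k.ne_zero
  have hk' : conj (w.embedding (k : K)) ≠ 0 := (map_ne_zero _).mpr hk
  rw [zpow_neg, zpow_neg]
  field_simp

/-- **`ω₀` is trivial on the ray**: for `k ∈ Kˣ` with `(k) ∈ W_𝔣` (`k ≡ 1 mod^× 𝔣`, `k` totally
positive), `ω₀((k)) = 1`.  Writing `k = b/d` with `d` prime to `𝔣` (`exists_denom_prime_to`),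
`b ≡ d mod 𝔣` and `b/d ≫ 0`, so `χ̃((b)) = χ̃((d)) ∏_w σ_w(k)^{p_w} σ̄_w(k)^{q_w}` by the Größencharakter
relation, while `A_{p,q}((k)_∞) = ∏_w σ_w(k)^{-p_w} σ̄_w(k)^{-q_w}`.  Ref: Neukirch, *Algebraic Number
Theory*, Ch. VII §6 (6.13)–(6.14); Cassels–Fröhlich, Ch. VII §4.1.
[cite: NeukirchANT1999, Ch. VII §6 Prop. (6.13) and Cor. (6.14)] -/
theorem grossIdeleValue_principalIdele_eq_one (h𝔣 : 𝔣 ≠ ⊥) (hψ : IsGrossencharakter 𝔣 p q ψ)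
    {k : Kˣ} (hk : principalIdele K k ∈ congruenceIdeles 𝔣) : grossIdeleValue hψ (principalIdele K k) = 1 := by
  classical
  obtain ⟨d, hd0, hdS, hint⟩ := exists_denom_prime_to h𝔣 k
    fun v hv => valuation_eq_one_of_principalIdele_mem hk hv
  -- the numerator `b = d k`
  obtain ⟨b, hb⟩ := HeightOneSpectrum.mem_integers_of_valuation_le_one K ((d : K) * k) hint
  have hb' : (b : K) = (d : K) * k := hb
  have hd' : (d : K) ≠ 0 := fun h => hd0 (by exact_mod_cast h)
  have hb0 : b ≠ 0 := by
    intro h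
    rw [h] at hb'
    exact mul_ne_zero hd' k.ne_zero (by exact_mod_cast hb'.symm)
  have hbd' : (b : K) / d = k := by rw [hb', mul_div_cancel_left₀ _ hd']
  -- `d` prime to `𝔣`
  have hdcop : IsCoprime (Ideal.span {d}) 𝔣 := by
    refine (LFunctions.isCoprime_iff_forall_not_le h𝔣).mpr fun v hv hle => ?_
    exact hdS v ((modulusExp_ne_zero_iff 𝔣 h𝔣 v).mpr hv) ((Ideal.span_singleton_le_iff_mem _).mp hle)
  -- `b ≡ d mod 𝔣`
  have hbd : b - d ∈ 𝔣 := by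
    have e : ((b - d : 𝓞 K) : K) = (d : K) * ((k : K) - 1) := by
      change algebraMap (𝓞 K) K (b - d) = _
      rw [map_sub, hb]
      change (d : K) * k - (d : K) = _
      ring
    refine mem_of_forall_mem_pow_modulusExp h𝔣 fun v hv => ?_
    rw [← intValuation_le_pow_iff_mem, ← valuation_of_algebraMap (K := K)]
    change v.valuation K ((b - d : 𝓞 K) : K) ≤ _
    rw [e, map_mul]
    calc v.valuation K (d : K) * v.valuation K ((k : K) - 1)
        ≤ 1 * WithZero.exp (-(modulusExp 𝔣 v : ℤ)) :=
          mul_le_mul' (valuation_le_one v d) (valuation_sub_one_le_of_principalIdele_mem hk hv)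
      _ = _ := one_mul _
  have hbcop : IsCoprime (Ideal.span {b}) 𝔣 := LFunctions.isCoprime_span_of_sub_mem hdcop hbd
  -- `b/d` is totally positive
  have hpos : ∀ φ : K →+* ℝ, 0 < φ b * φ d := by
    intro φ
    have hφd : φ d ≠ 0 := (map_ne_zero φ).mpr hd'
    rw [hb', map_mul]
    have : φ (d : K) * φ (k : K) * φ (d : K) = φ (d : K) ^ 2 * φ (k : K) := by ring
    rw [this]
    have hk0 : 0 < φ (k : K) := pos_of_principalIdele_mem_congruenceIdeles hk φ
    positivity
  have hray := hψ.idealPow_span_eq b d hb0 hd0 hdcop hbd hpos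
  rw [hbd'] at hray
  -- compute the finite part `χ̃((k)) = χ̃((b)) / χ̃((d))`
  have hcount := ideleOrd_principalIdele_eq_count_sub_count hb0 hd0 hb'
  have e : grossFinValue hψ (principalIdele K k) =
      (∏ᶠ v : HeightOneSpectrum (𝓞 K), grossUnitValue hψ v ^
          ((Associates.mk v.asIdeal).count (Associates.mk (Ideal.span {b} : Ideal (𝓞 K))).factors : ℤ)) /
        ∏ᶠ v : HeightOneSpectrum (𝓞 K), grossUnitValue hψ v ^
          ((Associates.mk v.asIdeal).count (Associates.mk (Ideal.span {d} : Ideal (𝓞 K))).factors : ℤ) := by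
    unfold grossFinValue
    rw [← finprod_div_distrib (mulSupport_grossUnitValue_pow_count_finite hψ hb0)
      (mulSupport_grossUnitValue_pow_count_finite hψ hd0)]
    exact finprod_congr fun v => by rw [hcount v, zpow_sub, div_eq_mul_inv]
  have hD : LFunctions.idealPow K ψ (Ideal.span {d}) ≠ 0 := by
    rw [← coe_finprod_grossUnitValue_pow_count h𝔣 hψ hd0 hdcop]; exact Units.ne_zero _
  refine Units.ext ?_
  rw [grossIdeleValue_def, Units.val_mul, e, Units.val_div_eq_div_val,
    coe_finprod_grossUnitValue_pow_count h𝔣 hψ hb0 hbcop, coe_finprod_grossUnitValue_pow_count h𝔣 hψ hd0 hdcop,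
    hray, HeckeCharacter.coe_archIdeleChar_apply, HeckeCharacter.infPart_principalIdele, Units.val_one,
    mul_div_cancel_left₀ _ hD, mul_comm]
  exact archFactor_globalToInfiniteUnits_mul_prod p q k

end IdeleValue

end Literature.NumberTheory.GaloisRepresentations

end
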